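/-
Copyright (c) 2026. Released under Apache 2.0 license.
-/
import Literature.NumberTheory.Automorphic.UnboundedDenominatorsInvariantHomLayerCentral
import HarnessLib

/-!
# The invariant form of CDT Cor. 4.5.3: the depth step at `p^e`, `p` odd, via the modular relation

Let `p` be an odd prime, `gcd(m', p) = 1`, `N = m'p^{n+2}` and `θ : Γ(N) → Q` an `SL₂(ℤ)`-conjugation-invariant
homomorphism of `p`-power exponent.  **Then `θ` is trivial on `Γ(N) ∩ ([SL₂(ℤ), Γ(m'p^{n+1})] · K_θ)`**
(`map_eq_one_of_mem_commutator_top_layer`): in `G = SL₂(ℤ)/K_θ` the centre `Z` (image of `Γ(N)`) meets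
`[G, Â]` trivially, where `Â` is the (abelian, `Γ(p)`-central) image of the top layer `Γ(m'p^{n+1})`
(`UnboundedDenominatorsInvariantHomLayerCentral`).  This is the `p`-part of the statement that the Schur
multiplier of `SL₂(ℤ/p^e)` vanishes for odd `p` ([Beyl1986]), obtained here by an explicit argument:
`[G, Â] = [T̂, Â]·[Ŝ, Â]`; an element `[T̂, â₁][Ŝ, â₂]` of `Z` equals `w^{i}` for one explicit `w` (layer
coordinates `𝔰𝔩₂(𝔽_p)`, the exact relations `[T, T^{m'p^{n+1}}] = 1` and `S² = -1`); and `w = 1` follows from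
expanding the modular relation `T S T S T S⁻¹ = 1` against a lift of `H = diag(1,-1)`.
[cite: CalegariDimitrovTang2025, Corollary 4.5.3] [cite: Beyl1986, Theorem]
-/

open scoped MatrixGroups commutatorElement

namespace Literature.NumberTheory.Automorphic

namespace UnboundedDenominators

open CongruenceSubgroup Matrix.SpecialLinearGroup ModularGroup

variable {Q : Type*} [CommGroup Q]

/-- `Γ(L) ≤ Γ(M)` for `M ∣ L`. [folklore] -/
private theorem Gamma_le_Gamma_of_dvd₁₁ {M L : ℕ} (h : M ∣ L) : Gamma L ≤ Gamma M := by
  intro γ hγ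
  obtain ⟨h00, h01, h10, h11⟩ := Gamma_mem.mp hγ
  have cast_eq : ∀ a : ℤ, ((a : ZMod L).cast : ZMod M) = (a : ZMod M) := fun a ↦
    ZMod.cast_intCast h a
  rw [Gamma_mem]
  refine ⟨?_, ?_, ?_, ?_⟩
  · rw [← cast_eq, h00, ZMod.cast_one h]
  · rw [← cast_eq, h01, ZMod.cast_zero]
  · rw [← cast_eq, h10, ZMod.cast_zero]
  · rw [← cast_eq, h11, ZMod.cast_one h]

/-- `T^M ∈ Γ(M)`. [folklore] -/
private theorem T_pow_mem_Gamma'' (M : ℕ) : T ^ M ∈ Gamma M := by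
  have := ModularGroup_T_pow_mem_Gamma (M : ℤ) (M : ℤ) (dvd_refl _)
  rwa [zpow_natCast, Int.natAbs_natCast] at this

/-- `S² = -1` is central in `SL₂(ℤ)`. [folklore] -/
private theorem S_mul_S_comm'' (g : SL(2, ℤ)) : S * S * g = g * (S * S) := by
  have hS2 : (S : Matrix (Fin 2) (Fin 2) ℤ) * (S : Matrix (Fin 2) (Fin 2) ℤ) = -1 := by
    rw [coe_S]
    ext i j
    fin_cases i <;> fin_cases j <;> simp [Matrix.mul_apply, Fin.sum_univ_two]
  apply Subtype.ext
  simp only [Matrix.SpecialLinearGroup.coe_mul]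
  rw [hS2, neg_one_mul, mul_neg_one]

/-- The modular relation `T S T S T = S` in `SL₂(ℤ)`. [folklore] -/
private theorem T_S_T_S_T_eq : T * S * T * S * T = S := by
  apply Subtype.ext
  simp only [Matrix.SpecialLinearGroup.coe_mul, coe_S, coe_T]
  ext i j
  fin_cases i <;> fin_cases j <;> simp [Matrix.mul_apply, Fin.sum_univ_two]

/-- **The depth step at `p^e` for odd `p`.**  For an odd prime `p`, `gcd(m', p) = 1` and an
`SL₂(ℤ)`-conjugation-invariant `θ : Γ(m'p^{n+2}) → Q` of `p`-power exponent, `θ` kills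
`Γ(m'p^{n+2}) ∩ ([SL₂(ℤ), Γ(m'p^{n+1})] · K_θ)`.  [cite: CalegariDimitrovTang2025, Corollary 4.5.3]
[cite: Beyl1986, Theorem] -/
theorem map_eq_one_of_mem_commutator_top_layer {p m' n a : ℕ} (hp : p.Prime) (hp2 : p ≠ 2) [NeZero m']
    (hmm : m'.Coprime p) (θ : Gamma (m' * p ^ (n + 2)) →* Q)
    (hθ : ∀ (g x : SL(2, ℤ)) (hx : x ∈ Gamma (m' * p ^ (n + 2))) (hgx : g * x * g⁻¹ ∈ Gamma (m' * p ^ (n + 2))),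
      θ ⟨g * x * g⁻¹, hgx⟩ = θ ⟨x, hx⟩)
    (he : ∀ x : Gamma (m' * p ^ (n + 2)), θ x ^ (p ^ a) = 1) :
    ∀ (y : SL(2, ℤ)) (hy : y ∈ Gamma (m' * p ^ (n + 2))),
      y ∈ ⁅(⊤ : Subgroup SL(2, ℤ)), Gamma (m' * p ^ (n + 1))⁆ ⊔ θ.ker.map (Gamma (m' * p ^ (n + 2))).subtype →
      θ ⟨y, hy⟩ = 1 := by
  classical
  haveI : Fact p.Prime := ⟨hp⟩
  haveI : NeZero p := ⟨hp.ne_zero⟩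
  haveI := ker_map_subtype_normal θ hθ
  have hm0 : m' ≠ 0 := NeZero.ne m'
  haveI := Gamma_normal (m' * p ^ (n + 2))
  haveI := Gamma_normal (m' * p ^ (n + 1))
  haveI := Gamma_normal p
  set K : Subgroup SL(2, ℤ) := θ.ker.map (Gamma (m' * p ^ (n + 2))).subtype with hKdef
  set π : SL(2, ℤ) →* SL(2, ℤ) ⧸ K := QuotientGroup.mk' K with hπ
  -- notation-free abbreviations for the two levels
  have hNA : Gamma (m' * p ^ (n + 2)) ≤ Gamma (m' * p ^ (n + 1)) :=
    Gamma_le_Gamma_of_dvd₁₁ (mul_dvd_mul_left m' (pow_dvd_pow p (by omega)))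
  have hAp : Gamma (m' * p ^ (n + 1)) ≤ Gamma p :=
    Gamma_le_Gamma_of_dvd₁₁ (Dvd.dvd.mul_left (dvd_pow_self p (by omega)) m')
  -- the quotient: basic facts
  have hπone : ∀ (w : SL(2, ℤ)) (hw : w ∈ Gamma (m' * p ^ (n + 2))), π w = 1 → θ ⟨w, hw⟩ = 1 := by
    intro w hw h1
    rw [hπ, QuotientGroup.mk'_apply, QuotientGroup.eq_one_iff] at h1
    obtain ⟨_, h⟩ := (mem_ker_map_subtype_iff θ).mp h1
    exact h
  have hZmem : ∀ w : SL(2, ℤ), π w = 1 → w ∈ Gamma (m' * p ^ (n + 2)) := by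
    intro w hw
    rw [hπ, QuotientGroup.mk'_apply, QuotientGroup.eq_one_iff] at hw
    exact ker_map_subtype_le θ hw
  have hcentralN : ∀ w ∈ Gamma (m' * p ^ (n + 2)), ∀ g : SL(2, ℤ) ⧸ K, ⁅g, π w⁆ = 1 := by
    intro w hw g
    have hc' : π w ∈ Subgroup.center (SL(2, ℤ) ⧸ K) := mk_mem_center_of_mem_Gamma θ hθ hw
    rw [commutatorElement_def, Subgroup.mem_center_iff.mp hc' g]; group
  -- the top layer is central under `Γ(p)` (LayerCentral)
  have hAcomm : ∀ {u v : SL(2, ℤ)}, u ∈ Gamma p → v ∈ Gamma (m' * p ^ (n + 1)) → ⁅π u, π v⁆ = 1 := by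
    intro u v hu hv
    have huv : ⁅u, v⁆ ∈ Gamma (m' * p ^ (n + 2)) :=
      Gamma_le_Gamma_of_dvd₁₁ ⟨1, by ring⟩ (commutatorElement_mem_Gamma_mul_of_mem hu hv)
    have h := map_commutatorElement_layer_eq_one hp hp2 hmm θ hθ he hu hv huv
    rw [← map_commutatorElement, hπ, QuotientGroup.mk'_apply, QuotientGroup.eq_one_iff]
    exact (mem_ker_map_subtype_iff θ).mpr ⟨huv, h⟩
  have hAcomm' : ∀ {u v : SL(2, ℤ)}, u ∈ Gamma p → v ∈ Gamma (m' * p ^ (n + 1)) → π u * π v = π v * π u :=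
    fun {u v} hu hv ↦ commutatorElement_eq_one_iff_mul_comm.mp (hAcomm hu hv)
  -- `δ_g(a) = [g, a]` on the top layer: homomorphisms killing `Γ(N)`, with `p`-torsion values
  have hδmem : ∀ (g a : SL(2, ℤ)), a ∈ Gamma (m' * p ^ (n + 1)) → ⁅g, a⁆ ∈ Gamma (m' * p ^ (n + 1)) := by
    intro g a ha
    rw [commutatorElement_def]
    exact mul_mem ((Gamma_normal _).conj_mem a ha g) (inv_mem ha)
  have hδmul : ∀ (g a b : SL(2, ℤ)), a ∈ Gamma (m' * p ^ (n + 1)) → b ∈ Gamma (m' * p ^ (n + 1)) →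
      π ⁅g, a * b⁆ = π ⁅g, a⁆ * π ⁅g, b⁆ := by
    intro g a b ha hb
    have h1 : ⁅g, a * b⁆ = ⁅g, a⁆ * (a * ⁅g, b⁆ * a⁻¹) := by simp only [commutatorElement_def]; group
    rw [h1, map_mul, map_mul, map_mul, map_inv, hAcomm' (hAp ha) (hδmem g b hb), mul_inv_cancel_right]
  have hδone : ∀ (g a : SL(2, ℤ)), a ∈ Gamma (m' * p ^ (n + 2)) → π ⁅g, a⁆ = 1 := by
    intro g a ha
    rw [map_commutatorElement]
    exact hcentralN a ha (π g)
  have hδinv : ∀ (g a : SL(2, ℤ)), a ∈ Gamma (m' * p ^ (n + 1)) → π ⁅g, a⁻¹⁆ = (π ⁅g, a⁆)⁻¹ := by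
    intro g a ha
    have h := hδmul g a a⁻¹ ha (inv_mem ha)
    rw [mul_inv_cancel, commutatorElement_one_right, map_one] at h
    exact (inv_eq_of_mul_eq_one_right h.symm).symm
  have hδpow : ∀ (g a : SL(2, ℤ)), a ∈ Gamma (m' * p ^ (n + 1)) → ∀ k : ℕ, π ⁅g, a ^ k⁆ = π ⁅g, a⁆ ^ k := by
    intro g a ha k
    induction k with
    | zero => simp
    | succ k ih => rw [pow_succ, hδmul g _ _ (pow_mem ha k) ha, ih, pow_succ]
  have hδzpow : ∀ (g a : SL(2, ℤ)), a ∈ Gamma (m' * p ^ (n + 1)) → ∀ k : ℤ, π ⁅g, a ^ k⁆ = π ⁅g, a⁆ ^ k := by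
    intro g a ha k
    rcases Int.eq_nat_or_neg k with ⟨l, rfl | rfl⟩
    · rw [zpow_natCast, zpow_natCast, hδpow g a ha]
    · rw [zpow_neg, zpow_natCast, zpow_neg, zpow_natCast, hδinv g _ (pow_mem ha l), hδpow g a ha]
  have hδtors : ∀ (g a : SL(2, ℤ)), a ∈ Gamma (m' * p ^ (n + 1)) → π ⁅g, a⁆ ^ p = 1 := by
    intro g a ha
    have hap : a ^ p ∈ Gamma (m' * p ^ (n + 2)) := by
      have h := pow_mem_Gamma_mul_of_dvd (Dvd.dvd.mul_left (dvd_pow_self p (by omega : n + 1 ≠ 0)) m') ha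
      rwa [show m' * p ^ (n + 1) * p = m' * p ^ (n + 2) by ring] at h
    rw [← hδpow g a ha, hδone g _ hap]
  -- congruence mod `Γ(N)` does not change `π [g, ·]`
  have hδcongr : ∀ (g a b : SL(2, ℤ)), a ∈ Gamma (m' * p ^ (n + 1)) → b ∈ Gamma (m' * p ^ (n + 1)) →
      a * b⁻¹ ∈ Gamma (m' * p ^ (n + 2)) → π ⁅g, a⁆ = π ⁅g, b⁆ := by
    intro g a b ha hb hab
    have h := hδmul g (a * b⁻¹) b (hNA hab) hb
    rw [inv_mul_cancel_right, hδone g _ hab, one_mul] at h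
    exact h
  -- `[G, Â] = [T̂, Â] · [Ŝ, Â]`: every `π [g, a]` is `π [T, a₁] · π [S, a₂]`
  have hdecomp : ∀ (g a : SL(2, ℤ)), a ∈ Gamma (m' * p ^ (n + 1)) →
      ∃ a₁ a₂ : SL(2, ℤ), a₁ ∈ Gamma (m' * p ^ (n + 1)) ∧ a₂ ∈ Gamma (m' * p ^ (n + 1)) ∧
        π ⁅g, a⁆ = π ⁅T, a₁⁆ * π ⁅S, a₂⁆ := by
    intro g
    have hg : g ∈ Subgroup.closure ({S, T} : Set SL(2, ℤ)) := by
      rw [SpecialLinearGroup.SL2Z_generators]; exact Subgroup.mem_top g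
    induction hg using Subgroup.closure_induction with
    | mem x hx =>
      intro a ha
      rcases hx with rfl | rfl
      · exact ⟨1, a, one_mem _, ha, by rw [commutatorElement_one_right, map_one, one_mul]⟩
      · exact ⟨a, 1, ha, one_mem _, by rw [commutatorElement_one_right, map_one, mul_one]⟩
    | one =>
      intro a ha
      exact ⟨1, 1, one_mem _, one_mem _, by
        rw [commutatorElement_one_left, commutatorElement_one_right, commutatorElement_one_right, map_one,
          mul_one]⟩
    | mul x y _ _ ihx ihy =>
      intro a ha
      have hya : y * a * y⁻¹ ∈ Gamma (m' * p ^ (n + 1)) := (Gamma_normal _).conj_mem a ha y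
      obtain ⟨a₁, a₂, ha₁, ha₂, h1⟩ := ihx (y * a * y⁻¹) hya
      obtain ⟨b₁, b₂, hb₁, hb₂, h2⟩ := ihy a ha
      refine ⟨a₁ * b₁, a₂ * b₂, mul_mem ha₁ hb₁, mul_mem ha₂ hb₂, ?_⟩
      rw [show ⁅x * y, a⁆ = ⁅x, y * a * y⁻¹⁆ * ⁅y, a⁆ by simp only [commutatorElement_def]; group, map_mul, h1,
        h2, hδmul T a₁ b₁ ha₁ hb₁, hδmul S a₂ b₂ ha₂ hb₂]
      have hc : π ⁅S, a₂⁆ * π ⁅T, b₁⁆ = π ⁅T, b₁⁆ * π ⁅S, a₂⁆ :=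
        hAcomm' (hAp (hδmem S a₂ ha₂)) (hδmem T b₁ hb₁)
      calc π ⁅T, a₁⁆ * π ⁅S, a₂⁆ * (π ⁅T, b₁⁆ * π ⁅S, b₂⁆)
          = π ⁅T, a₁⁆ * (π ⁅S, a₂⁆ * π ⁅T, b₁⁆) * π ⁅S, b₂⁆ := by group
        _ = π ⁅T, a₁⁆ * (π ⁅T, b₁⁆ * π ⁅S, a₂⁆) * π ⁅S, b₂⁆ := by rw [hc]
        _ = π ⁅T, a₁⁆ * π ⁅T, b₁⁆ * (π ⁅S, a₂⁆ * π ⁅S, b₂⁆) := by group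
    | inv x _ ih =>
      intro a ha
      have hxa : x⁻¹ * a * x ∈ Gamma (m' * p ^ (n + 1)) := by
        simpa using (Gamma_normal (m' * p ^ (n + 1))).conj_mem a ha x⁻¹
      obtain ⟨a₁, a₂, ha₁, ha₂, h1⟩ := ih (x⁻¹ * a * x) hxa
      refine ⟨a₁⁻¹, a₂⁻¹, inv_mem ha₁, inv_mem ha₂, ?_⟩
      rw [show ⁅x⁻¹, a⁆ = ⁅x, x⁻¹ * a * x⁆⁻¹ by simp only [commutatorElement_def]; group, map_inv, h1,
        hδinv T a₁ ha₁, hδinv S a₂ ha₂, mul_inv_rev]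
      have hc := hAcomm' (hAp (hδmem S a₂ ha₂)) (hδmem T a₁ ha₁)
      rw [← mul_inv_rev, ← mul_inv_rev, hc]
  -- the subgroup `M = {π[T,a₁] π[S,a₂]}` contains `π [SL₂(ℤ), Γ_{n+1}]`
  have hMmul : ∀ (a₁ a₂ b₁ b₂ : SL(2, ℤ)), a₁ ∈ Gamma (m' * p ^ (n + 1)) → a₂ ∈ Gamma (m' * p ^ (n + 1)) →
      b₁ ∈ Gamma (m' * p ^ (n + 1)) → b₂ ∈ Gamma (m' * p ^ (n + 1)) →
      π ⁅T, a₁⁆ * π ⁅S, a₂⁆ * (π ⁅T, b₁⁆ * π ⁅S, b₂⁆) = π ⁅T, a₁ * b₁⁆ * π ⁅S, a₂ * b₂⁆ := by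
    intro a₁ a₂ b₁ b₂ ha₁ ha₂ hb₁ hb₂
    have hc : π ⁅S, a₂⁆ * π ⁅T, b₁⁆ = π ⁅T, b₁⁆ * π ⁅S, a₂⁆ :=
      hAcomm' (hAp (hδmem S a₂ ha₂)) (hδmem T b₁ hb₁)
    rw [hδmul T a₁ b₁ ha₁ hb₁, hδmul S a₂ b₂ ha₂ hb₂]
    calc π ⁅T, a₁⁆ * π ⁅S, a₂⁆ * (π ⁅T, b₁⁆ * π ⁅S, b₂⁆)
        = π ⁅T, a₁⁆ * (π ⁅S, a₂⁆ * π ⁅T, b₁⁆) * π ⁅S, b₂⁆ := by group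
      _ = π ⁅T, a₁⁆ * (π ⁅T, b₁⁆ * π ⁅S, a₂⁆) * π ⁅S, b₂⁆ := by rw [hc]
      _ = π ⁅T, a₁⁆ * π ⁅T, b₁⁆ * (π ⁅S, a₂⁆ * π ⁅S, b₂⁆) := by group
  have hyM : ∀ (y : SL(2, ℤ)), y ∈ ⁅(⊤ : Subgroup SL(2, ℤ)), Gamma (m' * p ^ (n + 1))⁆ →
      ∃ a₁ a₂ : SL(2, ℤ), a₁ ∈ Gamma (m' * p ^ (n + 1)) ∧ a₂ ∈ Gamma (m' * p ^ (n + 1)) ∧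
        π y = π ⁅T, a₁⁆ * π ⁅S, a₂⁆ := by
    -- the explicit subgroup
    let M : Subgroup (SL(2, ℤ) ⧸ K) :=
      { carrier := {z | ∃ a₁ a₂ : SL(2, ℤ), a₁ ∈ Gamma (m' * p ^ (n + 1)) ∧
          a₂ ∈ Gamma (m' * p ^ (n + 1)) ∧ z = π ⁅T, a₁⁆ * π ⁅S, a₂⁆}
        mul_mem' := by
          rintro _ _ ⟨a₁, a₂, ha₁, ha₂, rfl⟩ ⟨b₁, b₂, hb₁, hb₂, rfl⟩
          exact ⟨a₁ * b₁, a₂ * b₂, mul_mem ha₁ hb₁, mul_mem ha₂ hb₂, hMmul a₁ a₂ b₁ b₂ ha₁ ha₂ hb₁ hb₂⟩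
        one_mem' := ⟨1, 1, one_mem _, one_mem _, by
          rw [commutatorElement_one_right, commutatorElement_one_right, map_one, mul_one]⟩
        inv_mem' := by
          rintro _ ⟨a₁, a₂, ha₁, ha₂, rfl⟩
          refine ⟨a₁⁻¹, a₂⁻¹, inv_mem ha₁, inv_mem ha₂, ?_⟩
          have hc := hAcomm' (hAp (hδmem S a₂ ha₂)) (hδmem T a₁ ha₁)
          rw [hδinv T a₁ ha₁, hδinv S a₂ ha₂, mul_inv_rev, ← mul_inv_rev, ← mul_inv_rev, hc] }
    have hle : (⁅(⊤ : Subgroup SL(2, ℤ)), Gamma (m' * p ^ (n + 1))⁆).map π ≤ M := by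
      rw [Subgroup.map_commutator, Subgroup.commutator_le]
      rintro _ ⟨g, -, rfl⟩ _ ⟨a, ha, rfl⟩
      obtain ⟨a₁, a₂, ha₁, ha₂, h⟩ := hdecomp g a ha
      exact ⟨a₁, a₂, ha₁, ha₂, by rw [← map_commutatorElement, h]⟩
    intro y hy
    obtain ⟨a₁, a₂, ha₁, ha₂, h⟩ := hle ⟨y, hy, rfl⟩
    exact ⟨a₁, a₂, ha₁, ha₂, h⟩
  -- layer coordinates at the top layer and the generators `u_E, u_F, u_H`
  have hq0 : m' * p ^ (n + 1) ≠ 0 := Nat.mul_ne_zero hm0 (pow_ne_zero _ hp.ne_zero)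
  have hpq : p ∣ m' * p ^ (n + 1) := Dvd.dvd.mul_left (dvd_pow_self p (by omega)) m'
  obtain ⟨Φ, -, P2, P3, P4, P5, P6, P7⟩ := exists_layerCoord_mul (m' * p ^ (n + 1)) p hq0 hpq
  have hkerN : ∀ {w : SL(2, ℤ)}, w ∈ Gamma (m' * p ^ (n + 1) * p) ↔ w ∈ Gamma (m' * p ^ (n + 2)) := by
    intro w; rw [show m' * p ^ (n + 1) * p = m' * p ^ (n + 2) by ring]
  set uE : SL(2, ℤ) := T ^ (m' * p ^ (n + 1)) with huE
  set uF : SL(2, ℤ) := S * uE * S⁻¹ with huF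
  set uH : SL(2, ℤ) := T * uF * T⁻¹ with huH
  have mE : uE ∈ Gamma (m' * p ^ (n + 1)) := T_pow_mem_Gamma'' _
  have mF : uF ∈ Gamma (m' * p ^ (n + 1)) := (Gamma_normal _).conj_mem _ mE S
  have mH : uH ∈ Gamma (m' * p ^ (n + 1)) := (Gamma_normal _).conj_mem _ mF T
  have t00 : ((T : SL(2, ℤ)) 0 0 : ℤ) = 1 := by simp [coe_T]
  have t01 : ((T : SL(2, ℤ)) 0 1 : ℤ) = 1 := by simp [coe_T]
  have t10 : ((T : SL(2, ℤ)) 1 0 : ℤ) = 0 := by simp [coe_T]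
  have t11 : ((T : SL(2, ℤ)) 1 1 : ℤ) = 1 := by simp [coe_T]
  have s00 : ((S : SL(2, ℤ)) 0 0 : ℤ) = 0 := by simp [coe_S]
  have s01 : ((S : SL(2, ℤ)) 0 1 : ℤ) = -1 := by simp [coe_S]
  have s10 : ((S : SL(2, ℤ)) 1 0 : ℤ) = 1 := by simp [coe_S]
  have s11 : ((S : SL(2, ℤ)) 1 1 : ℤ) = 0 := by simp [coe_S]
  have ΦE : Φ ⟨uE, mE⟩ = Multiplicative.ofAdd (0, 1, 0) := P5 mE
  have ΦF : Φ ⟨uF, mF⟩ = Multiplicative.ofAdd (0, 0, -1) := P6 mF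
  have ΦH : Φ ⟨uH, mH⟩ = Multiplicative.ofAdd (-1, 1, -1) := by
    refine (P4 T uF mF mH 0 0 (-1) ΦF).trans ?_
    rw [t00, t01, t10, t11]; push_cast; congr 1; norm_num
  -- the Ad-formulas for `T` and `S` on coordinates
  have ΦT : ∀ (a : SL(2, ℤ)) (ha : a ∈ Gamma (m' * p ^ (n + 1))) (α β κ : ZMod p),
      Φ ⟨a, ha⟩ = Multiplicative.ofAdd (α, β, κ) →
      Φ ⟨⁅T, a⁆, hδmem T a ha⟩ = Multiplicative.ofAdd (κ, -κ - 2 * α, 0) := by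
    intro a ha α β κ h
    have hTa : T * a * T⁻¹ ∈ Gamma (m' * p ^ (n + 1)) := (Gamma_normal _).conj_mem a ha T
    have h1 := P4 T a ha hTa α β κ h
    rw [t00, t01, t10, t11] at h1
    have h2 : (⟨⁅T, a⁆, hδmem T a ha⟩ : Gamma (m' * p ^ (n + 1))) = ⟨T * a * T⁻¹, hTa⟩ * ⟨a, ha⟩⁻¹ :=
      Subtype.ext (by simp [commutatorElement_def])
    rw [h2, map_mul, map_inv, h1, h, ← ofAdd_neg, ← ofAdd_add]
    congr 1
    push_cast
    rw [Prod.neg_mk, Prod.neg_mk, Prod.mk_add_mk, Prod.mk_add_mk, Prod.mk.injEq, Prod.mk.injEq]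
    exact ⟨by ring, by ring, by ring⟩
  have ΦS : ∀ (a : SL(2, ℤ)) (ha : a ∈ Gamma (m' * p ^ (n + 1))) (α β κ : ZMod p),
      Φ ⟨a, ha⟩ = Multiplicative.ofAdd (α, β, κ) →
      Φ ⟨⁅S, a⁆, hδmem S a ha⟩ = Multiplicative.ofAdd (-2 * α, -κ - β, -β - κ) := by
    intro a ha α β κ h
    have hSa : S * a * S⁻¹ ∈ Gamma (m' * p ^ (n + 1)) := (Gamma_normal _).conj_mem a ha S
    have h1 := P4 S a ha hSa α β κ h
    rw [s00, s01, s10, s11] at h1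
    have h2 : (⟨⁅S, a⁆, hδmem S a ha⟩ : Gamma (m' * p ^ (n + 1))) = ⟨S * a * S⁻¹, hSa⟩ * ⟨a, ha⟩⁻¹ :=
      Subtype.ext (by simp [commutatorElement_def])
    rw [h2, map_mul, map_inv, h1, h, ← ofAdd_neg, ← ofAdd_add]
    congr 1
    push_cast
    rw [Prod.neg_mk, Prod.neg_mk, Prod.mk_add_mk, Prod.mk_add_mk, Prod.mk.injEq, Prod.mk.injEq]
    exact ⟨by ring, by ring, by ring⟩
  -- exact relations: `[T, u_E] = 1`, `[S, u_E u_F] = [u_F, u_E]`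
  have ζE : π ⁅T, uE⁆ = 1 := by
    rw [huE, commutatorElement_eq_one_iff_mul_comm.mpr ((Commute.refl T).pow_right _).eq, map_one]
  have ζEF : π ⁅S, uE⁆ * π ⁅S, uF⁆ = 1 := by
    rw [← hδmul S uE uF mE mF]
    have h1 : ⁅S, uE * uF⁆ = ⁅uF, uE⁆ := by
      rw [huF, commutatorElement_def, commutatorElement_def,
        show S * (uE * (S * uE * S⁻¹)) * S⁻¹ * (uE * (S * uE * S⁻¹))⁻¹ =
          (S * uE * S⁻¹) * (S * S * uE * (S * S)⁻¹) * (S * uE * S⁻¹)⁻¹ * uE⁻¹ by group,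
        S_mul_S_comm'' uE, mul_inv_cancel_right]
    rw [h1]
    exact hAcomm (hAp mF) mE
  have ζF : π ⁅S, uF⁆ = (π ⁅S, uE⁆)⁻¹ := (inv_eq_of_mul_eq_one_right ζEF).symm
  -- the four basic values and `w'`
  have cTH : π ⁅T, uH⁆ * π ⁅T, uF⁆ = π ⁅T, uF⁆ * π ⁅T, uH⁆ :=
    hAcomm' (hAp (hδmem T uH mH)) (hδmem T uF mF)
  have cTS : π ⁅T, uH⁆ * π ⁅S, uH⁆ = π ⁅S, uH⁆ * π ⁅T, uH⁆ :=
    hAcomm' (hAp (hδmem T uH mH)) (hδmem S uH mH)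
  have cFS : π ⁅T, uF⁆ * π ⁅S, uH⁆ = π ⁅S, uH⁆ * π ⁅T, uF⁆ :=
    hAcomm' (hAp (hδmem T uF mF)) (hδmem S uH mH)
  set w' : SL(2, ℤ) ⧸ K := π ⁅T, uH⁆ * π ⁅T, uF⁆ ^ (-3 : ℤ) * (π ⁅S, uH⁆)⁻¹ with hw'
  -- exponents only matter mod `p`
  have hzmod : ∀ (x : SL(2, ℤ) ⧸ K), x ^ p = 1 → ∀ (u v : ℤ), (u : ZMod p) = (v : ZMod p) → x ^ u = x ^ v := by
    intro x hx u v huv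
    obtain ⟨c, hc⟩ := (ZMod.intCast_eq_intCast_iff_dvd_sub u v p).mp huv
    rw [show v = u + (p : ℤ) * c by linear_combination hc, zpow_add, zpow_mul, zpow_natCast, hx, one_zpow,
      mul_one]
  have hw'pow : ∀ i : ℤ, w' ^ i = π ⁅T, uH⁆ ^ i * π ⁅T, uF⁆ ^ (-3 * i) * (π ⁅S, uH⁆ ^ i)⁻¹ := by
    intro i
    have c1 : Commute (π ⁅T, uH⁆) (π ⁅T, uF⁆ ^ (-3 : ℤ)) := (Commute.zpow_right cTH (-3))
    have c2 : Commute (π ⁅T, uH⁆ * π ⁅T, uF⁆ ^ (-3 : ℤ)) (π ⁅S, uH⁆)⁻¹ :=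
      Commute.inv_right (Commute.mul_left cTS (Commute.zpow_left cFS (-3)))
    rw [hw', c2.mul_zpow, c1.mul_zpow, ← zpow_mul, inv_zpow]
  have hw'p : w' ^ (p : ℤ) = 1 := by
    rw [hw'pow, zpow_natCast, zpow_natCast, ← hδpow T uH mH, ← hδpow S uH mH,
      hδone T _ ?_, hδone S _ ?_, one_mul, inv_one, mul_one, mul_comm (-3 : ℤ), zpow_mul, zpow_natCast,
      ← hδpow T uF mF, hδone T _ ?_, one_zpow]
    all_goals
      first
      | exact (hkerN.mp (pow_mem_Gamma_mul_of_dvd hpq mH))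
      | exact (hkerN.mp (pow_mem_Gamma_mul_of_dvd hpq mF))
  have hw'p' : w' ^ p = 1 := by rw [← zpow_natCast]; exact hw'p
  -- CLAIM 1: a central `π[T,a₁] π[S,a₂]` is a power of `w'` with exponent `-α(a₁)`
  have hclaim : ∀ (a₁ a₂ : SL(2, ℤ)) (ha₁ : a₁ ∈ Gamma (m' * p ^ (n + 1)))
      (ha₂ : a₂ ∈ Gamma (m' * p ^ (n + 1))) (α₁ β₁ κ₁ : ZMod p),
      Φ ⟨a₁, ha₁⟩ = Multiplicative.ofAdd (α₁, β₁, κ₁) →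
      ⁅T, a₁⁆ * ⁅S, a₂⁆ ∈ Gamma (m' * p ^ (n + 2)) →
      ∃ i : ℤ, (i : ZMod p) = -α₁ ∧ π ⁅T, a₁⁆ * π ⁅S, a₂⁆ = w' ^ i := by
    intro a₁ a₂ ha₁ ha₂ α₁ β₁ κ₁ hΦ₁ hmem
    obtain ⟨i, j, k, h1⟩ := P7 uH uE uF mH mE mF ΦH ΦE ΦF a₁ ha₁
    obtain ⟨i', j', k', h2⟩ := P7 uH uE uF mH mE mF ΦH ΦE ΦF a₂ ha₂
    have hg₁ : uH ^ i * uE ^ j * uF ^ k ∈ Gamma (m' * p ^ (n + 1)) :=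
      mul_mem (mul_mem (zpow_mem mH i) (zpow_mem mE j)) (zpow_mem mF k)
    have hg₂ : uH ^ i' * uE ^ j' * uF ^ k' ∈ Gamma (m' * p ^ (n + 1)) :=
      mul_mem (mul_mem (zpow_mem mH i') (zpow_mem mE j')) (zpow_mem mF k')
    -- coordinates of `a₁`, `a₂`
    have hΦg : ∀ (i j k : ℤ) (hg : uH ^ i * uE ^ j * uF ^ k ∈ Gamma (m' * p ^ (n + 1))),
        Φ ⟨uH ^ i * uE ^ j * uF ^ k, hg⟩ =
          Multiplicative.ofAdd ((-i : ZMod p), (i + j : ZMod p), (-i - k : ZMod p)) := by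
      intro i j k hg
      have h3 : (⟨uH ^ i * uE ^ j * uF ^ k, hg⟩ : Gamma (m' * p ^ (n + 1))) =
          ⟨uH, mH⟩ ^ i * ⟨uE, mE⟩ ^ j * ⟨uF, mF⟩ ^ k := Subtype.ext (by simp)
      rw [h3, map_mul, map_mul, map_zpow, map_zpow, map_zpow, ΦH, ΦE, ΦF]
      apply Multiplicative.toAdd.injective
      simp only [toAdd_mul, toAdd_zpow, toAdd_ofAdd, Prod.smul_mk, Prod.mk_add_mk, zsmul_eq_mul,
        Prod.mk.injEq]
      exact ⟨by ring, by ring, by ring⟩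
    have hΦa₁ : Φ ⟨a₁, ha₁⟩ = Φ ⟨uH ^ i * uE ^ j * uF ^ k, hg₁⟩ := by
      have h3 := P2 _ (mul_mem ha₁ (inv_mem hg₁)) h1
      have h4 : (⟨a₁ * (uH ^ i * uE ^ j * uF ^ k)⁻¹, mul_mem ha₁ (inv_mem hg₁)⟩ :
          Gamma (m' * p ^ (n + 1))) = ⟨a₁, ha₁⟩ * ⟨uH ^ i * uE ^ j * uF ^ k, hg₁⟩⁻¹ := rfl
      rw [h4, map_mul, map_inv, mul_inv_eq_one] at h3
      exact h3
    have hΦa₂ : Φ ⟨a₂, ha₂⟩ = Φ ⟨uH ^ i' * uE ^ j' * uF ^ k', hg₂⟩ := by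
      have h3 := P2 _ (mul_mem ha₂ (inv_mem hg₂)) h2
      have h4 : (⟨a₂ * (uH ^ i' * uE ^ j' * uF ^ k')⁻¹, mul_mem ha₂ (inv_mem hg₂)⟩ :
          Gamma (m' * p ^ (n + 1))) = ⟨a₂, ha₂⟩ * ⟨uH ^ i' * uE ^ j' * uF ^ k', hg₂⟩⁻¹ := rfl
      rw [h4, map_mul, map_inv, mul_inv_eq_one] at h3
      exact h3
    rw [hΦg i j k hg₁] at hΦa₁
    rw [hΦg i' j' k' hg₂] at hΦa₂
    have hcoord : ((-i : ZMod p), (i + j : ZMod p), (-i - k : ZMod p)) = (α₁, β₁, κ₁) :=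
      Multiplicative.ofAdd.injective (hΦa₁.symm.trans hΦ₁)
    simp only [Prod.mk.injEq] at hcoord
    obtain ⟨hα₁, hβ₁, hκ₁⟩ := hcoord
    -- the three equations from `Φ([T,a₁][S,a₂]) = 1`
    have hT1 := ΦT a₁ ha₁ _ _ _ hΦa₁
    have hS2 := ΦS a₂ ha₂ _ _ _ hΦa₂
    have hprod : (⟨⁅T, a₁⁆ * ⁅S, a₂⁆, mul_mem (hδmem T a₁ ha₁) (hδmem S a₂ ha₂)⟩ :
        Gamma (m' * p ^ (n + 1))) = ⟨⁅T, a₁⁆, hδmem T a₁ ha₁⟩ * ⟨⁅S, a₂⁆, hδmem S a₂ ha₂⟩ := rfl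
    have hone := P2 _ (mul_mem (hδmem T a₁ ha₁) (hδmem S a₂ ha₂)) (hkerN.mpr hmem)
    rw [hprod, map_mul, hT1, hS2, ← ofAdd_add, ← ofAdd_zero] at hone
    have heq := Multiplicative.ofAdd.injective hone
    simp only [Prod.mk_add_mk, Prod.mk_eq_zero] at heq
    obtain ⟨e1, e2, e3⟩ := heq
    have h2u : (2 : ZMod p) ≠ 0 := by
      intro h0
      have hd : (p : ℕ) ∣ 2 := (ZMod.natCast_eq_zero_iff 2 p).mp (by exact_mod_cast h0)
      exact hp2 ((Nat.prime_dvd_prime_iff_eq hp Nat.prime_two).mp hd)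
    have rk : ((k : ℤ) : ZMod p) = ((-3 * i : ℤ) : ZMod p) := by
      push_cast; linear_combination e2 - e3
    have ri' : ((i' : ℤ) : ZMod p) = ((-i : ℤ) : ZMod p) := by
      push_cast
      have h5 : (2 : ZMod p) * (i' + i) = 0 := by linear_combination e1 + e2 - e3
      rcases mul_eq_zero.mp h5 with h | h
      · exact absurd h h2u
      · linear_combination h
    have rj' : ((k' : ℤ) : ZMod p) = ((j' : ℤ) : ZMod p) := by
      linear_combination e3
    -- `p`-torsion of the basic values
    have tT : ∀ a ∈ Gamma (m' * p ^ (n + 1)), π ⁅T, a⁆ ^ p = 1 := fun a ha ↦ hδtors T a ha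
    have tS : ∀ a ∈ Gamma (m' * p ^ (n + 1)), π ⁅S, a⁆ ^ p = 1 := fun a ha ↦ hδtors S a ha
    -- expand
    refine ⟨i, by rw [← hα₁]; ring, ?_⟩
    rw [hδcongr T a₁ _ ha₁ hg₁ (hkerN.mp h1), hδcongr S a₂ _ ha₂ hg₂ (hkerN.mp h2),
      hδmul T _ _ (mul_mem (zpow_mem mH i) (zpow_mem mE j)) (zpow_mem mF k),
      hδmul T _ _ (zpow_mem mH i) (zpow_mem mE j),
      hδmul S _ _ (mul_mem (zpow_mem mH i') (zpow_mem mE j')) (zpow_mem mF k'),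
      hδmul S _ _ (zpow_mem mH i') (zpow_mem mE j'),
      hδzpow T uH mH, hδzpow T uE mE, hδzpow T uF mF, hδzpow S uH mH, hδzpow S uE mE, hδzpow S uF mF, ζE,
      one_zpow, mul_one, ζF, inv_zpow', hzmod _ (tT uF mF) k (-3 * i) rk, hzmod _ (tS uH mH) i' (-i) ri',
      hzmod _ (tS uE mE) (-k') (-j') (by push_cast; rw [rj']), hw'pow i, mul_assoc (π ⁅S, uH⁆ ^ (-i)),
      ← zpow_add, add_neg_cancel, zpow_zero, mul_one, zpow_neg]
  -- CLAIM 2: `w' = 1`, from the modular relation `T S T S T S⁻¹ = 1` against a lift `h₀` of `H`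
  have hw'1 : w' = 1 := by
    set h₀ : SL(2, ℤ) := uE * uF * uH⁻¹ with hh₀
    have mh₀ : h₀ ∈ Gamma (m' * p ^ (n + 1)) := mul_mem (mul_mem mE mF) (inv_mem mH)
    have Φh₀ : Φ ⟨h₀, mh₀⟩ = Multiplicative.ofAdd (1, 0, 0) := by
      have h3 : (⟨h₀, mh₀⟩ : Gamma (m' * p ^ (n + 1))) = ⟨uE, mE⟩ * ⟨uF, mF⟩ * ⟨uH, mH⟩⁻¹ := rfl
      rw [h3, map_mul, map_mul, map_inv, ΦE, ΦF, ΦH, ← ofAdd_add, ← ofAdd_neg, ← ofAdd_add]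
      congr 1
      norm_num
    -- the suffixes of the word and their conjugates of `h₀`
    have hs1 : S * T * S * T * S⁻¹ = T⁻¹ := by
      have h := T_S_T_S_T_eq
      calc S * T * S * T * S⁻¹ = T⁻¹ * (T * S * T * S * T) * S⁻¹ := by group
        _ = T⁻¹ := by rw [h, mul_inv_cancel_right]
    set x₁ : SL(2, ℤ) := T⁻¹ * h₀ * T⁻¹⁻¹ with hx₁
    set x₂ : SL(2, ℤ) := (T * S * T * S⁻¹) * h₀ * (T * S * T * S⁻¹)⁻¹ with hx₂
    set x₃ : SL(2, ℤ) := (S * T * S⁻¹) * h₀ * (S * T * S⁻¹)⁻¹ with hx₃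
    set x₄ : SL(2, ℤ) := (T * S⁻¹) * h₀ * (T * S⁻¹)⁻¹ with hx₄
    set x₅ : SL(2, ℤ) := S⁻¹ * h₀ * S⁻¹⁻¹ with hx₅
    have mx : ∀ g : SL(2, ℤ), g * h₀ * g⁻¹ ∈ Gamma (m' * p ^ (n + 1)) := fun g ↦
      (Gamma_normal _).conj_mem _ mh₀ g
    have mx₁ : x₁ ∈ Gamma (m' * p ^ (n + 1)) := mx _
    have mx₂ : x₂ ∈ Gamma (m' * p ^ (n + 1)) := mx _
    have mx₃ : x₃ ∈ Gamma (m' * p ^ (n + 1)) := mx _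
    have mx₄ : x₄ ∈ Gamma (m' * p ^ (n + 1)) := mx _
    have mx₅ : x₅ ∈ Gamma (m' * p ^ (n + 1)) := mx _
    -- the expansion of `[T S T S T S⁻¹, h₀] = [1, h₀] = 1`
    have hword : ⁅T, x₁⁆ * ⁅S, x₂⁆ * ⁅T, x₃⁆ * ⁅S, x₄⁆ * ⁅T, x₅⁆ * ⁅S⁻¹, h₀⁆ = 1 := by
      have h1 : ⁅T * S * T * S * T * S⁻¹, h₀⁆ =
          ⁅T, x₁⁆ * ⁅S, x₂⁆ * ⁅T, x₃⁆ * ⁅S, x₄⁆ * ⁅T, x₅⁆ * ⁅S⁻¹, h₀⁆ := by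
        rw [hx₁, hx₂, hx₃, hx₄, hx₅, ← hs1]
        simp only [commutatorElement_def]
        group
      rw [← h1, T_S_T_S_T_eq, mul_inv_cancel, commutatorElement_one_left]
    have hSinv : ⁅S⁻¹, h₀⁆ = ⁅S, h₀⁆ := by
      have h1 : S * h₀ * S⁻¹ = S⁻¹ * h₀ * S := by
        calc S * h₀ * S⁻¹ = S⁻¹ * (S * S * h₀) * S⁻¹ := by group
          _ = S⁻¹ * (h₀ * (S * S)) * S⁻¹ := by rw [S_mul_S_comm'' h₀]
          _ = S⁻¹ * h₀ * S := by group
      rw [commutatorElement_def, commutatorElement_def, inv_inv, ← h1]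
    rw [hSinv] at hword
    -- regroup in `G`: `π[T, x₁x₃x₅] · π[S, x₂x₄h₀] = 1`
    set A₁ : SL(2, ℤ) := x₁ * x₃ * x₅ with hA₁
    set A₂ : SL(2, ℤ) := x₂ * x₄ * h₀ with hA₂
    have mA₁ : A₁ ∈ Gamma (m' * p ^ (n + 1)) := mul_mem (mul_mem mx₁ mx₃) mx₅
    have mA₂ : A₂ ∈ Gamma (m' * p ^ (n + 1)) := mul_mem (mul_mem mx₂ mx₄) mh₀
    have hrel : π ⁅T, A₁⁆ * π ⁅S, A₂⁆ = 1 := by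
      have h1 := congrArg π hword
      rw [map_one, map_mul, map_mul, map_mul, map_mul, map_mul] at h1
      rw [hA₁, hA₂, hδmul T _ _ (mul_mem mx₁ mx₃) mx₅, hδmul T _ _ mx₁ mx₃, hδmul S _ _ (mul_mem mx₂ mx₄) mh₀,
        hδmul S _ _ mx₂ mx₄, ← h1]
      -- reorder six pairwise commuting factors
      have heb : π ⁅T, x₅⁆ * π ⁅S, x₂⁆ = π ⁅S, x₂⁆ * π ⁅T, x₅⁆ :=
        hAcomm' (hAp (hδmem T x₅ mx₅)) (hδmem S x₂ mx₂)
      have hcb : π ⁅T, x₃⁆ * π ⁅S, x₂⁆ = π ⁅S, x₂⁆ * π ⁅T, x₃⁆ :=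
        hAcomm' (hAp (hδmem T x₃ mx₃)) (hδmem S x₂ mx₂)
      have hed : π ⁅T, x₅⁆ * π ⁅S, x₄⁆ = π ⁅S, x₄⁆ * π ⁅T, x₅⁆ :=
        hAcomm' (hAp (hδmem T x₅ mx₅)) (hδmem S x₄ mx₄)
      calc π ⁅T, x₁⁆ * π ⁅T, x₃⁆ * π ⁅T, x₅⁆ * (π ⁅S, x₂⁆ * π ⁅S, x₄⁆ * π ⁅S, h₀⁆)
          = π ⁅T, x₁⁆ * π ⁅T, x₃⁆ * (π ⁅T, x₅⁆ * π ⁅S, x₂⁆) * π ⁅S, x₄⁆ * π ⁅S, h₀⁆ := by group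
        _ = π ⁅T, x₁⁆ * π ⁅T, x₃⁆ * (π ⁅S, x₂⁆ * π ⁅T, x₅⁆) * π ⁅S, x₄⁆ * π ⁅S, h₀⁆ := by rw [heb]
        _ = π ⁅T, x₁⁆ * (π ⁅T, x₃⁆ * π ⁅S, x₂⁆) * (π ⁅T, x₅⁆ * π ⁅S, x₄⁆) * π ⁅S, h₀⁆ := by group
        _ = π ⁅T, x₁⁆ * (π ⁅S, x₂⁆ * π ⁅T, x₃⁆) * (π ⁅S, x₄⁆ * π ⁅T, x₅⁆) * π ⁅S, h₀⁆ := by rw [hcb, hed]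
        _ = π ⁅T, x₁⁆ * π ⁅S, x₂⁆ * π ⁅T, x₃⁆ * π ⁅S, x₄⁆ * π ⁅T, x₅⁆ * π ⁅S, h₀⁆ := by group
    have hmemA : ⁅T, A₁⁆ * ⁅S, A₂⁆ ∈ Gamma (m' * p ^ (n + 2)) := by
      apply hZmem; rw [map_mul, hrel]
    -- the first coordinate of `A₁` is `1`
    have hTi : ((T⁻¹ : SL(2, ℤ)) : Matrix (Fin 2) (Fin 2) ℤ) = !![1, -1; 0, 1] := coe_T_inv
    have i00 : ((T⁻¹ : SL(2, ℤ)) 0 0 : ℤ) = 1 := by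
      rw [show ((T⁻¹ : SL(2, ℤ)) 0 0 : ℤ) = ((T⁻¹ : SL(2, ℤ)) : Matrix (Fin 2) (Fin 2) ℤ) 0 0 from rfl, hTi]; simp
    have i01 : ((T⁻¹ : SL(2, ℤ)) 0 1 : ℤ) = -1 := by
      rw [show ((T⁻¹ : SL(2, ℤ)) 0 1 : ℤ) = ((T⁻¹ : SL(2, ℤ)) : Matrix (Fin 2) (Fin 2) ℤ) 0 1 from rfl, hTi]; simp
    have i10 : ((T⁻¹ : SL(2, ℤ)) 1 0 : ℤ) = 0 := by
      rw [show ((T⁻¹ : SL(2, ℤ)) 1 0 : ℤ) = ((T⁻¹ : SL(2, ℤ)) : Matrix (Fin 2) (Fin 2) ℤ) 1 0 from rfl, hTi]; simp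
    have i11 : ((T⁻¹ : SL(2, ℤ)) 1 1 : ℤ) = 1 := by
      rw [show ((T⁻¹ : SL(2, ℤ)) 1 1 : ℤ) = ((T⁻¹ : SL(2, ℤ)) : Matrix (Fin 2) (Fin 2) ℤ) 1 1 from rfl, hTi]; simp
    have hSi : ((S⁻¹ : SL(2, ℤ)) : Matrix (Fin 2) (Fin 2) ℤ) = !![0, 1; -1, 0] := by
      simp [Matrix.SpecialLinearGroup.coe_inv, coe_S, Matrix.adjugate_fin_two]
    have j00 : ((S⁻¹ : SL(2, ℤ)) 0 0 : ℤ) = 0 := by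
      rw [show ((S⁻¹ : SL(2, ℤ)) 0 0 : ℤ) = ((S⁻¹ : SL(2, ℤ)) : Matrix (Fin 2) (Fin 2) ℤ) 0 0 from rfl, hSi]; simp
    have j01 : ((S⁻¹ : SL(2, ℤ)) 0 1 : ℤ) = 1 := by
      rw [show ((S⁻¹ : SL(2, ℤ)) 0 1 : ℤ) = ((S⁻¹ : SL(2, ℤ)) : Matrix (Fin 2) (Fin 2) ℤ) 0 1 from rfl, hSi]; simp
    have j10 : ((S⁻¹ : SL(2, ℤ)) 1 0 : ℤ) = -1 := by
      rw [show ((S⁻¹ : SL(2, ℤ)) 1 0 : ℤ) = ((S⁻¹ : SL(2, ℤ)) : Matrix (Fin 2) (Fin 2) ℤ) 1 0 from rfl, hSi]; simp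
    have j11 : ((S⁻¹ : SL(2, ℤ)) 1 1 : ℤ) = 0 := by
      rw [show ((S⁻¹ : SL(2, ℤ)) 1 1 : ℤ) = ((S⁻¹ : SL(2, ℤ)) : Matrix (Fin 2) (Fin 2) ℤ) 1 1 from rfl, hSi]; simp
    have k00 : ((S * T * S⁻¹ : SL(2, ℤ)) 0 0 : ℤ) = 1 := by
      rw [show ((S * T * S⁻¹ : SL(2, ℤ)) 0 0 : ℤ) = ((S * T * S⁻¹ : SL(2, ℤ)) : Matrix (Fin 2) (Fin 2) ℤ) 0 0
        from rfl, Matrix.SpecialLinearGroup.coe_mul, Matrix.SpecialLinearGroup.coe_mul, hSi, coe_S, coe_T]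
      simp [Matrix.mul_apply, Fin.sum_univ_two]
    have k01 : ((S * T * S⁻¹ : SL(2, ℤ)) 0 1 : ℤ) = 0 := by
      rw [show ((S * T * S⁻¹ : SL(2, ℤ)) 0 1 : ℤ) = ((S * T * S⁻¹ : SL(2, ℤ)) : Matrix (Fin 2) (Fin 2) ℤ) 0 1
        from rfl, Matrix.SpecialLinearGroup.coe_mul, Matrix.SpecialLinearGroup.coe_mul, hSi, coe_S, coe_T]
      simp [Matrix.mul_apply, Fin.sum_univ_two]
    have k10 : ((S * T * S⁻¹ : SL(2, ℤ)) 1 0 : ℤ) = -1 := by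
      rw [show ((S * T * S⁻¹ : SL(2, ℤ)) 1 0 : ℤ) = ((S * T * S⁻¹ : SL(2, ℤ)) : Matrix (Fin 2) (Fin 2) ℤ) 1 0
        from rfl, Matrix.SpecialLinearGroup.coe_mul, Matrix.SpecialLinearGroup.coe_mul, hSi, coe_S, coe_T]
      simp [Matrix.mul_apply, Fin.sum_univ_two]
    have k11 : ((S * T * S⁻¹ : SL(2, ℤ)) 1 1 : ℤ) = 1 := by
      rw [show ((S * T * S⁻¹ : SL(2, ℤ)) 1 1 : ℤ) = ((S * T * S⁻¹ : SL(2, ℤ)) : Matrix (Fin 2) (Fin 2) ℤ) 1 1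
        from rfl, Matrix.SpecialLinearGroup.coe_mul, Matrix.SpecialLinearGroup.coe_mul, hSi, coe_S, coe_T]
      simp [Matrix.mul_apply, Fin.sum_univ_two]
    have Φx₁ : Φ ⟨x₁, mx₁⟩ = Multiplicative.ofAdd (1, 2, 0) := by
      refine (P4 T⁻¹ h₀ mh₀ mx₁ 1 0 0 Φh₀).trans ?_
      rw [i00, i01, i10, i11]; push_cast; congr 1; norm_num
    have Φx₃ : Φ ⟨x₃, mx₃⟩ = Multiplicative.ofAdd (1, 0, -2) := by
      refine (P4 (S * T * S⁻¹) h₀ mh₀ mx₃ 1 0 0 Φh₀).trans ?_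
      rw [k00, k01, k10, k11]; push_cast; congr 1; norm_num
    have Φx₅ : Φ ⟨x₅, mx₅⟩ = Multiplicative.ofAdd (-1, 0, 0) := by
      refine (P4 S⁻¹ h₀ mh₀ mx₅ 1 0 0 Φh₀).trans ?_
      rw [j00, j01, j10, j11]; push_cast; congr 1; norm_num
    have ΦA₁ : Φ ⟨A₁, mA₁⟩ = Multiplicative.ofAdd (1, 2, -2) := by
      have h3 : (⟨A₁, mA₁⟩ : Gamma (m' * p ^ (n + 1))) = ⟨x₁, mx₁⟩ * ⟨x₃, mx₃⟩ * ⟨x₅, mx₅⟩ := rfl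
      rw [h3, map_mul, map_mul, Φx₁, Φx₃, Φx₅, ← ofAdd_add, ← ofAdd_add]
      congr 1
      norm_num
    obtain ⟨i, hi, hval⟩ := hclaim A₁ A₂ mA₁ mA₂ 1 2 (-2) ΦA₁ hmemA
    rw [hrel] at hval
    -- `w'^{-1} = w'^i = 1`
    have h4 : w' ^ (-1 : ℤ) = w' ^ i := hzmod w' hw'p' (-1) i (by rw [hi]; push_cast; ring)
    rw [← hval, zpow_neg, zpow_one, inv_eq_one] at h4
    exact h4
  -- conclusion
  intro y hy hyc
  have hyc' : y ∈ ⁅(⊤ : Subgroup SL(2, ℤ)), Gamma (m' * p ^ (n + 1))⁆ ⊔ K := hyc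
  rw [Subgroup.mem_sup_of_normal_right] at hyc'
  obtain ⟨u, hu, v, hv, huv⟩ := hyc'
  obtain ⟨a₁, a₂, ha₁, ha₂, hπu⟩ := hyM u hu
  have hv1 : π v = 1 := by
    rw [hπ, QuotientGroup.mk'_apply]; exact (QuotientGroup.eq_one_iff v).mpr hv
  have hπy : π y = π ⁅T, a₁⁆ * π ⁅S, a₂⁆ := by rw [← huv, map_mul, hv1, mul_one, hπu]
  have hcmem : ⁅T, a₁⁆ * ⁅S, a₂⁆ ∈ Gamma (m' * p ^ (n + 2)) := by
    have h1 : (⁅T, a₁⁆ * ⁅S, a₂⁆)⁻¹ * y ∈ Gamma (m' * p ^ (n + 2)) := by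
      apply hZmem; rw [map_mul, map_inv, map_mul, hπy, inv_mul_cancel]
    have h2 := mul_mem hy (inv_mem h1)
    rwa [show y * ((⁅T, a₁⁆ * ⁅S, a₂⁆)⁻¹ * y)⁻¹ = ⁅T, a₁⁆ * ⁅S, a₂⁆ by group] at h2
  obtain ⟨α₁, β₁, κ₁, hΦ₁⟩ : ∃ α₁ β₁ κ₁ : ZMod p, Φ ⟨a₁, ha₁⟩ = Multiplicative.ofAdd (α₁, β₁, κ₁) :=
    ⟨(Multiplicative.toAdd (Φ ⟨a₁, ha₁⟩)).1, (Multiplicative.toAdd (Φ ⟨a₁, ha₁⟩)).2.1,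
      (Multiplicative.toAdd (Φ ⟨a₁, ha₁⟩)).2.2, by simp⟩
  obtain ⟨i, -, hval⟩ := hclaim a₁ a₂ ha₁ ha₂ α₁ β₁ κ₁ hΦ₁ hcmem
  apply hπone
  rw [hπy, hval, hw'1, one_zpow]

end UnboundedDenominators

end Literature.NumberTheory.Automorphic
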